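import Mathlib
import Summits.AnomalousDissipation.AnomalousDissipation.Theorems.SoloBlindRecessiveTwoPoint

/-!
# The truncated two-point certificate (kernel #237, lemmaR-A3 §8(aa), PLAN §116)

Kernel #235 (`SoloBlindRecessiveTwoPoint`) reduces the streak Jost lemma [L1] to functionals of a
comparison sequence `W`: the Casoratian `C j = u j W (j+1) - W j u (j+1)` of the recessive solution
`u` against `W` is fed from infinity (`casoratian_tail`), the two-point representation bounds
`‖u k - u 0 W k‖` by `‖W k‖ Σ_{j<k} ‖C j‖ / (‖W j‖ ‖W (j+1)‖)` (`two_point_estimate`), and the linear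
a priori closure makes non-resonance an output (`nonresonance_apriori`).

The computer-assisted certificate (work/cert_s94/cert_L12.py, §8(aa)) does not bound the infinite
tail `T j = Σ_{i>j} ‖τ i‖`; it works at a FINITE truncation index `M` with the majorant

  `truncT W τ M j = Σ_{j ≤ i < M} ‖τ (i+1)‖ + ‖W M‖ + ‖W (M+1)‖`,

using `‖C M‖ ≤ S (‖W M‖ + ‖W (M+1)‖)` for `S = sup ‖u‖`.  This file packages exactly the
statement the certificate feeds: from the recurrence on rows `1 … M`, the sup `S` of `‖u‖` on
`[0, M+1]` attained at some `k ≤ K` (the Pringsheim lemma `pringsheim_monotone` of #235 supplies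
this with `K = K₃`), zero-freeness of `W` on `[0, K]`, `W 0 = 1`, the profile bound `‖W k‖ ≤ B` and the
contraction bound `‖W k‖ Σ_{j<k} truncT j / (‖W j‖ ‖W (j+1)‖) ≤ θ < 1` on `[0, K]`, it follows that
`S ≤ ‖u 0‖ B / (1 - θ)` (so `u 0 ≠ 0` unless `u ≡ 0` on `[0, M+1]`) and the Jost-datum transfer
`‖u 1 - u 0 W 1‖ ≤ S · truncT 0`.  All hypotheses on `W` are finitely many inequalities between
certified numbers.
-/

namespace Summit.AnomalousDissipation.AnomalousDissipation.Theorems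

open Complex

/-- The truncated Casoratian majorant `T̂ j = Σ_{j ≤ i < M} ‖τ (i+1)‖ + ‖W M‖ + ‖W (M+1)‖`. -/
noncomputable def truncT (W τ : ℕ → ℂ) (M j : ℕ) : ℝ :=
  (Finset.Ico j M).sum (fun i => ‖τ (i + 1)‖) + ‖W M‖ + ‖W (M + 1)‖

/-- The truncated majorant is non-negative. -/
theorem truncT_nonneg (W τ : ℕ → ℂ) (M j : ℕ) : 0 ≤ truncT W τ M j := by
  unfold truncT
  have := Finset.sum_nonneg (s := Finset.Ico j M) (f := fun i => ‖τ (i + 1)‖)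
    (fun i _ => norm_nonneg _)
  positivity

/-- TRUNCATED CASORATIAN BOUND: `‖C j‖ ≤ S · T̂ j` for `j ≤ M`, where `S` bounds `‖u i‖` on
`[0, M+1]`. -/
theorem casoratian_trunc_bound (u W : ℕ → ℂ) (c τ : ℕ → ℂ) (M : ℕ) (S : ℝ)
    (hu : ∀ k, k + 1 ≤ M → u (k + 2) - 2 * u (k + 1) + u k = c (k + 1) * u (k + 1))
    (hW : ∀ k, k + 1 ≤ M → W (k + 2) - 2 * W (k + 1) + W k - c (k + 1) * W (k + 1) = τ (k + 1))
    (hS : ∀ i, i ≤ M + 1 → ‖u i‖ ≤ S)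
    (j : ℕ) (hj : j ≤ M) :
    ‖casoratian u W j‖ ≤ S * truncT W τ M j := by
  have htail := casoratian_tail u W c τ M hu hW j hj
  have hIco : (Finset.range M).sum (fun i => u (i + 1) * τ (i + 1))
      - (Finset.range j).sum (fun i => u (i + 1) * τ (i + 1))
      = (Finset.Ico j M).sum (fun i => u (i + 1) * τ (i + 1)) :=
    (Finset.sum_Ico_eq_sub _ hj).symm
  rw [hIco] at htail
  have hCM : ‖casoratian u W M‖ ≤ S * (‖W M‖ + ‖W (M + 1)‖) := by
    unfold casoratian
    calc ‖u M * W (M + 1) - W M * u (M + 1)‖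
        ≤ ‖u M * W (M + 1)‖ + ‖W M * u (M + 1)‖ := norm_sub_le _ _
      _ = ‖u M‖ * ‖W (M + 1)‖ + ‖W M‖ * ‖u (M + 1)‖ := by rw [norm_mul, norm_mul]
      _ ≤ S * ‖W (M + 1)‖ + ‖W M‖ * S :=
          add_le_add (mul_le_mul_of_nonneg_right (hS M (by omega)) (norm_nonneg _))
            (mul_le_mul_of_nonneg_left (hS (M + 1) le_rfl) (norm_nonneg _))
      _ = S * (‖W M‖ + ‖W (M + 1)‖) := by ring
  have hsum : ‖(Finset.Ico j M).sum (fun i => u (i + 1) * τ (i + 1))‖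
      ≤ S * (Finset.Ico j M).sum (fun i => ‖τ (i + 1)‖) := by
    calc ‖(Finset.Ico j M).sum (fun i => u (i + 1) * τ (i + 1))‖
        ≤ (Finset.Ico j M).sum (fun i => ‖u (i + 1) * τ (i + 1)‖) := norm_sum_le _ _
      _ ≤ (Finset.Ico j M).sum (fun i => S * ‖τ (i + 1)‖) := by
          apply Finset.sum_le_sum
          intro i hi
          rw [Finset.mem_Ico] at hi
          rw [norm_mul]
          exact mul_le_mul_of_nonneg_right (hS (i + 1) (by omega)) (norm_nonneg _)
      _ = S * (Finset.Ico j M).sum (fun i => ‖τ (i + 1)‖) := by rw [Finset.mul_sum]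
  rw [htail]
  calc ‖casoratian u W M - (Finset.Ico j M).sum (fun i => u (i + 1) * τ (i + 1))‖
      ≤ ‖casoratian u W M‖ + ‖(Finset.Ico j M).sum (fun i => u (i + 1) * τ (i + 1))‖ :=
        norm_sub_le _ _
    _ ≤ S * (‖W M‖ + ‖W (M + 1)‖) + S * (Finset.Ico j M).sum (fun i => ‖τ (i + 1)‖) :=
        add_le_add hCM hsum
    _ = S * truncT W τ M j := by unfold truncT; ring

/-- TRUNCATED TWO-POINT ESTIMATE: for `k ≤ K ≤ M`,
`‖u k - u 0 W k‖ ≤ S · ‖W k‖ Σ_{j<k} T̂ j / (‖W j‖ ‖W (j+1)‖)`. -/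
theorem two_point_estimate_trunc (u W : ℕ → ℂ) (c τ : ℕ → ℂ) (K M : ℕ) (S : ℝ) (hKM : K ≤ M)
    (hu : ∀ k, k + 1 ≤ M → u (k + 2) - 2 * u (k + 1) + u k = c (k + 1) * u (k + 1))
    (hW : ∀ k, k + 1 ≤ M → W (k + 2) - 2 * W (k + 1) + W k - c (k + 1) * W (k + 1) = τ (k + 1))
    (hS : ∀ i, i ≤ M + 1 → ‖u i‖ ≤ S)
    (hWz : ∀ j, j ≤ K → W j ≠ 0) (hW0 : W 0 = 1) (k : ℕ) (hk : k ≤ K) :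
    ‖u k - u 0 * W k‖
      ≤ S * (‖W k‖ * (Finset.range k).sum
          (fun j => truncT W τ M j / (‖W j‖ * ‖W (j + 1)‖))) := by
  have h := two_point_estimate u W K hWz hW0 k hk
  have hterm : ∀ j ∈ Finset.range k,
      ‖casoratian u W j‖ / (‖W j‖ * ‖W (j + 1)‖)
        ≤ S * truncT W τ M j / (‖W j‖ * ‖W (j + 1)‖) := by
    intro j hj
    rw [Finset.mem_range] at hj
    exact div_le_div_of_nonneg_right
      (casoratian_trunc_bound u W c τ M S hu hW hS j (by omega)) (by positivity)
  have hsum := Finset.sum_le_sum hterm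
  calc ‖u k - u 0 * W k‖
      ≤ ‖W k‖ * (Finset.range k).sum
          (fun j => ‖casoratian u W j‖ / (‖W j‖ * ‖W (j + 1)‖)) := h
    _ ≤ ‖W k‖ * (Finset.range k).sum
          (fun j => S * truncT W τ M j / (‖W j‖ * ‖W (j + 1)‖)) :=
        mul_le_mul_of_nonneg_left hsum (norm_nonneg _)
    _ = S * (‖W k‖ * (Finset.range k).sum
          (fun j => truncT W τ M j / (‖W j‖ * ‖W (j + 1)‖))) := by
        rw [Finset.mul_sum, Finset.mul_sum, Finset.mul_sum]
        apply Finset.sum_congr rfl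
        intro j _
        ring

/-- THE STREAK CERTIFICATE THEOREM.  Hypotheses: the recurrence on rows `1 … M`; `S` bounds `‖u‖`
on `[0, M+1]` and is attained at some `k ≤ K` (Pringsheim); `W` zero-free on `[0, K]`, `W 0 = 1`,
`‖W k‖ ≤ B` and the truncated contraction functional `≤ θ < 1` on `[0, K]`, `K ≤ M`.
Conclusions: the a priori bound `S ≤ ‖u 0‖ B / (1 - θ)` (non-resonance) and the Jost-datum
transfer `‖u 1 - u 0 W 1‖ ≤ S · T̂ 0`. -/
theorem streak_certificate (u W : ℕ → ℂ) (c τ : ℕ → ℂ) (K M : ℕ) (S B θ : ℝ)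
    (hKM : K ≤ M) (hθ : θ < 1)
    (hu : ∀ k, k + 1 ≤ M → u (k + 2) - 2 * u (k + 1) + u k = c (k + 1) * u (k + 1))
    (hW : ∀ k, k + 1 ≤ M → W (k + 2) - 2 * W (k + 1) + W k - c (k + 1) * W (k + 1) = τ (k + 1))
    (hS : ∀ i, i ≤ M + 1 → ‖u i‖ ≤ S) (hSatt : ∃ k, k ≤ K ∧ S ≤ ‖u k‖)
    (hWz : ∀ j, j ≤ K → W j ≠ 0) (hW0 : W 0 = 1)
    (hB : ∀ k, k ≤ K → ‖W k‖ ≤ B)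
    (hΘ : ∀ k, k ≤ K → ‖W k‖ * (Finset.range k).sum
        (fun j => truncT W τ M j / (‖W j‖ * ‖W (j + 1)‖)) ≤ θ) :
    S ≤ ‖u 0‖ * B / (1 - θ) ∧ ‖u 1 - u 0 * W 1‖ ≤ S * truncT W τ M 0 := by
  have hS0 : 0 ≤ S := (norm_nonneg _).trans (hS 0 (by omega))
  constructor
  · apply nonresonance_apriori u W K S B θ hθ hB hSatt
    intro k hk
    have h1 := two_point_estimate_trunc u W c τ K M S hKM hu hW hS hWz hW0 k hk
    have h2 : S * (‖W k‖ * (Finset.range k).sum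
        (fun j => truncT W τ M j / (‖W j‖ * ‖W (j + 1)‖))) ≤ S * θ :=
      mul_le_mul_of_nonneg_left (hΘ k hk) hS0
    rw [mul_comm θ S]
    exact h1.trans h2
  · have hC0 : u 1 - u 0 * W 1 = - casoratian u W 0 := by
      unfold casoratian
      rw [hW0]; ring
    rw [hC0, norm_neg]
    exact casoratian_trunc_bound u W c τ M S hu hW hS 0 (by omega)

/-- Corollary (NON-RESONANCE): under the hypotheses of `streak_certificate`, if moreover `S` is a
genuine bound attained (so `S ≥ ‖u k‖` on `[0, K]`), then `u 0 = 0` forces `u ≡ 0` on `[0, K]`. -/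
theorem streak_certificate_head_ne_zero (u W : ℕ → ℂ) (c τ : ℕ → ℂ) (K M : ℕ) (S B θ : ℝ)
    (hKM : K ≤ M) (hθ : θ < 1)
    (hu : ∀ k, k + 1 ≤ M → u (k + 2) - 2 * u (k + 1) + u k = c (k + 1) * u (k + 1))
    (hW : ∀ k, k + 1 ≤ M → W (k + 2) - 2 * W (k + 1) + W k - c (k + 1) * W (k + 1) = τ (k + 1))
    (hS : ∀ i, i ≤ M + 1 → ‖u i‖ ≤ S) (hSatt : ∃ k, k ≤ K ∧ S ≤ ‖u k‖)
    (hWz : ∀ j, j ≤ K → W j ≠ 0) (hW0 : W 0 = 1)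
    (hB : ∀ k, k ≤ K → ‖W k‖ ≤ B)
    (hΘ : ∀ k, k ≤ K → ‖W k‖ * (Finset.range k).sum
        (fun j => truncT W τ M j / (‖W j‖ * ‖W (j + 1)‖)) ≤ θ)
    (h0 : u 0 = 0) : ∀ k, k ≤ K → u k = 0 := by
  have hSle := (streak_certificate u W c τ K M S B θ hKM hθ hu hW hS hSatt hWz hW0 hB hΘ).1
  rw [h0, norm_zero, zero_mul, zero_div] at hSle
  intro k hk
  have : ‖u k‖ ≤ 0 := (hS k (by omega)).trans hSle
  exact norm_le_zero_iff.mp this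

end Summit.AnomalousDissipation.AnomalousDissipation.Theorems
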